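import Literature.NumberTheory.ComplexMultiplication.FaltingsTateOfCMEllipticPowers
import Literature.NumberTheory.ComplexMultiplication.FaltingsTateOfCMElliptic
import Mathlib.FieldTheory.IntermediateField.Adjoin.Basic
import HarnessLib

/-!
# [Faltings 1983, §5 Kor. 1] for two CM structures with different multiplication fields

Theorems only (topic `NumberTheory/ComplexMultiplication`; no definition, no named fact, no instance).
Sequel of `FaltingsTateOfCMEllipticPowers` (pairs of powers of ONE CM elliptic structure) and
`FaltingsTateOfCMElliptic` (the pair `(A₀, A₀)`).

§1 (generic).  Let `P₁, P₂` be abelian varieties over a number field `k` with ring actions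
`ι_i : 𝓞_{K_i} → End P_i`, and let ONE `σ₀ ∈ Γ_k` act on `T_ℓ P_i` as the scalar `T_ℓ(ι_i π_i)`
(`π_i ∈ 𝓞_{K_i}`).  If `π₂` is NOT a root of the minimal polynomial `m₁` of `π₁`
(`aeval π₂ (minpoly ℤ π₁) ≠ 0`), then EVERY `Γ_k`-equivariant `ℤ_ℓ`-linear map
`λ : T_ℓ P₁ → T_ℓ P₂` vanishes (`tateHom_eq_zero_of_tateRep_eq_of_aeval_ne_zero`):
`λ ∘ T(ι₁ π₁) = T(ι₂ π₂) ∘ λ` gives `T(ι₂ (m₁(π₂))) ∘ λ = λ ∘ T(ι₁ (m₁(π₁))) = 0`, and `T(ι₂ u)` is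
injective for `u = m₁(π₂) ≠ 0` (`u` divides the non-zero integer `minpoly ℤ u (0)`; `T_ℓ P₂` is
torsion-free).  Hence the Tate map `ℤ_ℓ ⊗ Hom_k(P₁, P₂) → Hom_{Γ_k}(T_ℓ P₁, T_ℓ P₂) = 0` is bijective
(`bijective_faltingsTateMap_of_tateRep_eq_of_aeval_ne_zero`; injectivity is Mumford §19 Thm. 3,
`faltingsTateMap_injective_holds`) — Serre–Tate 1968 §4 style, no lattices, no [Fal83].
§2.  Powers keep a scalar Frobenius: the diagonal action `a ↦ ⨁ (ι₀ a)` on `⨁_{Fin r} A₀`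
(`exists_ringHom_biproduct_tateRep_eq`).
§3.  If `ℚ(π_i) = K_i` and `K₁ ≄ K₂` then `m₁(π₂) ≠ 0` (`aeval_minpoly_ne_zero_of_isEmpty_algEquiv`:
otherwise `minpoly ℚ π₁ = minpoly ℚ π₂` and `K₁ ≅ ℚ[X]/(m) ≅ K₂`).
§4.  For two CM ELLIPTIC structures `(A₁, ι₁)`, `(A₂, ι₂)` of types `(K₁, Φ₁)`, `(K₂, Φ₂)` over the
same `k`, ONE Frobenius at a degree-one place serves both (`exists_common_tateRep_eq_of_CM_elliptic_pair`
= `exists_tateRep_eq_tateModuleMap_and_adjoin_eq_top` run on the intersection of the two Shimura–Taniyama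
cofinite sets; granted [Shimura 1998, Thm. 18.6]); hence, when `K₁ ≄ K₂`,
**`faltings_tate_bijective A B ℓ` for every `A` isogenous to `A₁ᵃ` and `B` isogenous to `A₂ᵇ`**
(`faltings_tate_bijective_of_isIsogenous_pow_of_distinct_CM_elliptic_of_thm18_6`) — e.g. any powers of
`y² = x³ − x` (`K₁ = ℚ(i)`) against any powers of `y² = x³ + 1` (`K₂ = ℚ(√−3)`).

## References

* [Faltings1983Endlichkeit] G. Faltings, Invent. Math. 73 (1983), §5 Korollar 1 (the statement decided).
* [SerreTate1968] J.-P. Serre, J. Tate, Ann. of Math. 88 (1968), §4 Theorem 5 and Corollaries.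
* [Shimura1998] G. Shimura, *Abelian Varieties with Complex Multiplication and Modular Functions*
  (1998), §5.1 Proposition 3; §13.1 Theorem 1; §18.6 Theorem 18.6.
* [MumfordAV1970] D. Mumford, *Abelian Varieties* (1970), §19 Theorem 3 (injectivity).
-/

noncomputable section

open CategoryTheory CategoryTheory.Limits Polynomial
open scoped NumberField Pointwise IntermediateField TensorProduct

namespace Literature.NumberTheory.ComplexMultiplication

open Literature.AlgebraicGeometry.Motives Literature.AlgebraicGeometry.Motives.AbelianVariety

/-! ## §1 Equivariant maps between Tate modules with scalar Frobenii of unrelated minimal polynomials vanish -/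

/-- **Serre–Tate §4-style vanishing**: if one `σ₀ ∈ Γ_k` acts on `T_ℓ P₁` as `T_ℓ(ι₁ π₁)` and on
`T_ℓ P₂` as `T_ℓ(ι₂ π₂)` with `m₁(π₂) ≠ 0` for `m₁ = minpoly_ℤ(π₁)`, then every `Γ_k`-equivariant
`ℤ_ℓ`-linear map `T_ℓ P₁ → T_ℓ P₂` is zero (`λ T(ι₁ π₁) = T(ι₂ π₂) λ` ⇒ `T(ι₂ m₁(π₂)) λ = λ T(ι₁ m₁(π₁)) = 0`,
and `T(ι₂ u)` is injective for `u ≠ 0`). [cite: SerreTate1968, §4 Theorem 5 and Corollary 1]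
[cite: Shimura1998, §5.1 Proposition 3] -/
theorem tateHom_eq_zero_of_tateRep_eq_of_aeval_ne_zero
    {k : Type} [Field k] [NumberField k] {K₁ K₂ : Type*} [Field K₁] [NumberField K₁] [Field K₂]
    [NumberField K₂] (P₁ P₂ : AbelianVariety k) (ι₁ : 𝓞 K₁ →+* End P₁) (ι₂ : 𝓞 K₂ →+* End P₂)
    (ℓ : ℕ) [Fact ℓ.Prime] (σ₀ : Field.absoluteGaloisGroup k) (π₁ : 𝓞 K₁) (π₂ : 𝓞 K₂)
    (h₁ : P₁.tateRep ℓ σ₀ = tateModuleMap ℓ (ι₁ π₁ : P₁ ⟶ P₁))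
    (h₂ : P₂.tateRep ℓ σ₀ = tateModuleMap ℓ (ι₂ π₂ : P₂ ⟶ P₂))
    (hu : aeval π₂ (minpoly ℤ π₁) ≠ 0) (g : tateHom P₁ P₂ ℓ) : g = 0 := by
  classical
  have hℓk : (ℓ : k) ≠ 0 := Nat.cast_ne_zero.mpr (Fact.out : ℓ.Prime).ne_zero
  haveI := module_free_tateModule_holds P₂ ℓ hℓk
  -- the actions `T_ℓ ∘ ι_i` as ring homomorphisms
  let ιT₁ : 𝓞 K₁ →+* Module.End ℤ_[ℓ] (P₁.tateModule ℓ) :=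
    { toFun := fun a => tateModuleMap ℓ (ι₁ a : P₁ ⟶ P₁)
      map_one' := by simp only [map_one]; exact tateModuleMap_id ℓ P₁
      map_mul' := fun a b => by
        simp only [map_mul]
        change tateModuleMap ℓ ((ι₁ b : P₁ ⟶ P₁) ≫ (ι₁ a : P₁ ⟶ P₁)) = _
        rw [tateModuleMap_comp]; rfl
      map_zero' := by simp only [map_zero]; exact tateModuleMap_zero ℓ
      map_add' := fun a b => by simp only [map_add]; exact tateModuleMap_add ℓ _ _ }
  let ιT₂ : 𝓞 K₂ →+* Module.End ℤ_[ℓ] (P₂.tateModule ℓ) :=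
    { toFun := fun a => tateModuleMap ℓ (ι₂ a : P₂ ⟶ P₂)
      map_one' := by simp only [map_one]; exact tateModuleMap_id ℓ P₂
      map_mul' := fun a b => by
        simp only [map_mul]
        change tateModuleMap ℓ ((ι₂ b : P₂ ⟶ P₂) ≫ (ι₂ a : P₂ ⟶ P₂)) = _
        rw [tateModuleMap_comp]; rfl
      map_zero' := by simp only [map_zero]; exact tateModuleMap_zero ℓ
      map_add' := fun a b => by simp only [map_add]; exact tateModuleMap_add ℓ _ _ }
  have hιT₁ : ∀ a, ιT₁ a = tateModuleMap ℓ (ι₁ a : P₁ ⟶ P₁) := fun a => rfl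
  have hιT₂ : ∀ a, ιT₂ a = tateModuleMap ℓ (ι₂ a : P₂ ⟶ P₂) := fun a => rfl
  set lam : P₁.tateModule ℓ →ₗ[ℤ_[ℓ]] P₂.tateModule ℓ := g.toLinearMap with hlam
  -- `λ` intertwines the two Frobenius scalars
  have hsemi : ∀ t, lam (ιT₁ π₁ t) = ιT₂ π₂ (lam t) := fun t => by
    rw [hιT₁, hιT₂, ← h₁, ← h₂]
    exact Representation.IntertwiningMap.isIntertwining _ _ g σ₀ t
  have hpow : ∀ (n : ℕ) t, lam (((ιT₁ π₁) ^ n) t) = ((ιT₂ π₂) ^ n) (lam t) := by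
    intro n
    induction n with
    | zero => intro t; rw [pow_zero, pow_zero, Module.End.one_apply, Module.End.one_apply]
    | succ n ih => intro t; rw [pow_succ, pow_succ, Module.End.mul_apply, Module.End.mul_apply, ih, hsemi]
  have hpoly : ∀ (p : ℤ[X]) t, lam (aeval (ιT₁ π₁) p t) = aeval (ιT₂ π₂) p (lam t) := by
    intro p
    induction p using Polynomial.induction_on' with
    | add p q hp hq =>
      intro t
      rw [map_add, map_add, LinearMap.add_apply, LinearMap.add_apply, map_add, hp, hq]
    | monomial n c =>
      intro t
      rw [aeval_monomial, aeval_monomial, Module.End.mul_apply, Module.End.mul_apply,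
        algebraMap_int_eq, eq_intCast, eq_intCast, Module.End.intCast_apply,
        Module.End.intCast_apply, map_zsmul, hpow]
  -- `T(ι₂ (m₁ π₂)) ∘ λ = 0`
  have hkill : ∀ t, ιT₂ (aeval π₂ (minpoly ℤ π₁)) (lam t) = 0 := fun t => by
    have e₂ : ιT₂ (aeval π₂ (minpoly ℤ π₁)) = aeval (ιT₂ π₂) (minpoly ℤ π₁) := by
      change ιT₂.toIntAlgHom (aeval π₂ (minpoly ℤ π₁)) = _
      rw [← aeval_algHom_apply]; rfl
    have e₁ : ιT₁ (aeval π₁ (minpoly ℤ π₁)) = aeval (ιT₁ π₁) (minpoly ℤ π₁) := by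
      change ιT₁.toIntAlgHom (aeval π₁ (minpoly ℤ π₁)) = _
      rw [← aeval_algHom_apply]; rfl
    rw [e₂, ← hpoly, ← e₁, minpoly.aeval, map_zero, LinearMap.zero_apply, map_zero]
  -- `T(ι₂ u)` is injective for `u ≠ 0`: `w u = -d`, `d = (minpoly ℤ u)(0) ≠ 0`
  set u : 𝓞 K₂ := aeval π₂ (minpoly ℤ π₁) with hudef
  have huint : IsIntegral ℤ u := Algebra.IsIntegral.isIntegral u
  set d : ℤ := (minpoly ℤ u).coeff 0 with hd
  have hd0 : d ≠ 0 := by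
    -- the constant coefficient of the minimal polynomial over `ℚ` of `u ≠ 0` is non-zero
    have huK : IsIntegral ℤ (u : K₂) := NumberField.RingOfIntegers.isIntegral_coe u
    have huQ : IsIntegral ℚ (u : K₂) := huK.tower_top
    have hu' : (u : K₂) ≠ 0 := fun h => hu (NumberField.RingOfIntegers.coe_eq_zero_iff.mp h)
    have hq : (minpoly ℚ (u : K₂)).coeff 0 ≠ 0 := minpoly.coeff_zero_ne_zero huQ hu'
    rw [minpoly.isIntegrallyClosed_eq_field_fractions' ℚ huK, NumberField.RingOfIntegers.minpoly_coe u,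
      Polynomial.coeff_map] at hq
    rw [hd]
    exact fun h0 => hq (by rw [h0, map_zero])
  have hwu : (-aeval u (minpoly ℤ u).divX) * u = (d : 𝓞 K₂) := by
    have h0 : aeval u (minpoly ℤ u) = 0 := minpoly.aeval ℤ u
    rw [← Polynomial.X_mul_divX_add (minpoly ℤ u), map_add, map_mul, aeval_X, aeval_C,
      algebraMap_int_eq, eq_intCast] at h0
    rw [hd]
    linear_combination -h0
  have hinj : ∀ x, ιT₂ u x = 0 → x = 0 := fun x hx => by
    have h1 : ιT₂ (-aeval u (minpoly ℤ u).divX) (ιT₂ u x) = (d : ℤ_[ℓ]) • x := by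
      rw [← Module.End.mul_apply, ← map_mul, hwu, map_intCast, Module.End.intCast_apply,
        Int.cast_smul_eq_zsmul]
    rw [hx, map_zero] at h1
    exact (smul_eq_zero_iff_right (Int.cast_ne_zero.mpr hd0)).mp h1.symm
  -- conclude
  apply Representation.IntertwiningMap.ext
  refine LinearMap.ext fun t => ?_
  rw [Representation.IntertwiningMap.zero_toLinearMap, LinearMap.zero_apply]
  exact hinj _ (hkill t)

/-- **The Tate map is bijective onto `Hom_{Γ_k}(T_ℓ P₁, T_ℓ P₂) = 0`** under the hypotheses of
`tateHom_eq_zero_of_tateRep_eq_of_aeval_ne_zero`: injective by Mumford §19 Thm. 3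
(`faltingsTateMap_injective_holds`), surjective onto the zero module.
[cite: MumfordAV1970, §19 Theorem 3] [cite: SerreTate1968, §4 Theorem 5 and Corollary 1] -/
theorem bijective_faltingsTateMap_of_tateRep_eq_of_aeval_ne_zero
    {k : Type} [Field k] [NumberField k] {K₁ K₂ : Type*} [Field K₁] [NumberField K₁] [Field K₂]
    [NumberField K₂] (P₁ P₂ : AbelianVariety k) (ι₁ : 𝓞 K₁ →+* End P₁) (ι₂ : 𝓞 K₂ →+* End P₂)
    (ℓ : ℕ) [Fact ℓ.Prime] (σ₀ : Field.absoluteGaloisGroup k) (π₁ : 𝓞 K₁) (π₂ : 𝓞 K₂)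
    (h₁ : P₁.tateRep ℓ σ₀ = tateModuleMap ℓ (ι₁ π₁ : P₁ ⟶ P₁))
    (h₂ : P₂.tateRep ℓ σ₀ = tateModuleMap ℓ (ι₂ π₂ : P₂ ⟶ P₂))
    (hu : aeval π₂ (minpoly ℤ π₁) ≠ 0) : Function.Bijective (faltingsTateMap P₁ P₂ ℓ) := by
  have hℓk : (ℓ : k) ≠ 0 := Nat.cast_ne_zero.mpr (Fact.out : ℓ.Prime).ne_zero
  refine ⟨faltingsTateMap_injective_holds P₁ P₂ ℓ hℓk, fun g => ⟨0, ?_⟩⟩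
  rw [map_zero, tateHom_eq_zero_of_tateRep_eq_of_aeval_ne_zero P₁ P₂ ι₁ ι₂ ℓ σ₀ π₁ π₂ h₁ h₂ hu g]

/-! ## §2 Powers keep a scalar Frobenius -/

/-- **The diagonal action on a power has the same scalar Frobenius**: if `σ₀` acts on `T_ℓ A₀` as
`T_ℓ(ι₀ π)`, then for the diagonal ring action `ιr a = ⨁ (ι₀ a)` on `⨁_{Fin r} A₀`, `σ₀` acts on
`T_ℓ(⨁ A₀)` as `T_ℓ(ιr π)` (`T_ℓ` is additive: `T_ℓ(⨁ A₀) = Σ_i T_ℓ(ι_i) T_ℓ(π_i)`).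
[cite: MumfordAV1970, §19] -/
theorem exists_ringHom_biproduct_tateRep_eq
    {k : Type} [Field k] {K : Type*} [Field K] [NumberField K]
    (A₀ : AbelianVariety k) (ι₀ : 𝓞 K →+* End A₀) (ℓ : ℕ) [Fact ℓ.Prime]
    (σ₀ : Field.absoluteGaloisGroup k) (π : 𝓞 K)
    (hσ₀ : A₀.tateRep ℓ σ₀ = tateModuleMap ℓ (ι₀ π : A₀ ⟶ A₀)) (r : ℕ) :
    ∃ ιr : 𝓞 K →+* End (⨁ fun _ : Fin r => A₀),
      (⨁ fun _ : Fin r => A₀).tateRep ℓ σ₀ = tateModuleMap ℓ (ιr π : (⨁ fun _ : Fin r => A₀) ⟶ _) := by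
  classical
  set P : AbelianVariety k := ⨁ fun _ : Fin r => A₀ with hP
  let diag : 𝓞 K → (P ⟶ P) := fun a => biproduct.map fun _ : Fin r => (ι₀ a : A₀ ⟶ A₀)
  have hdiag : ∀ a, diag a = biproduct.map fun _ : Fin r => (ι₀ a : A₀ ⟶ A₀) := fun a => rfl
  have hone : diag 1 = 𝟙 P := by
    apply biproduct.hom_ext; intro j
    rw [hdiag, biproduct.map_π, Category.id_comp, map_one]
    exact Category.comp_id _
  have hmul : ∀ a b, diag (a * b) = diag b ≫ diag a := fun a b => by
    apply biproduct.hom_ext; intro j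
    rw [Category.assoc, hdiag, hdiag, hdiag, biproduct.map_π, biproduct.map_π, biproduct.map_π_assoc,
      map_mul]
    rfl
  have hzero : diag 0 = 0 := by
    apply biproduct.hom_ext; intro j
    rw [hdiag, biproduct.map_π, Limits.zero_comp, map_zero]
    exact Limits.comp_zero
  have hadd : ∀ a b, diag (a + b) = diag a + diag b := fun a b => by
    apply biproduct.hom_ext; intro j
    rw [Preadditive.add_comp, hdiag, hdiag, hdiag, biproduct.map_π, biproduct.map_π, biproduct.map_π,
      map_add]
    exact Preadditive.comp_add _ _ _ _ _ _
  let ιr : 𝓞 K →+* End P :=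
    { toFun := diag
      map_one' := hone
      map_mul' := hmul
      map_zero' := hzero
      map_add' := hadd }
  refine ⟨ιr, ?_⟩
  -- `T_ℓ` of the structure maps
  let Tι : Fin r → (A₀.tateModule ℓ →ₗ[ℤ_[ℓ]] P.tateModule ℓ) := fun i =>
    tateModuleMap ℓ (biproduct.ι (fun _ : Fin r => A₀) i)
  let Tπ : Fin r → (P.tateModule ℓ →ₗ[ℤ_[ℓ]] A₀.tateModule ℓ) := fun i =>
    tateModuleMap ℓ (biproduct.π (fun _ : Fin r => A₀) i)
  have htotal : ∀ x : P.tateModule ℓ, ∑ i, Tι i (Tπ i x) = x := fun x => by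
    have h1 : tateModuleMap ℓ (𝟙 P) x = x := by rw [tateModuleMap_id, LinearMap.id_apply]
    conv_rhs => rw [← h1, ← biproduct.total]
    have hsum : ∀ (s : Finset (Fin r)),
        tateModuleMap ℓ (∑ j ∈ s, biproduct.π (fun _ : Fin r => A₀) j ≫ biproduct.ι (fun _ : Fin r => A₀) j) =
          ∑ j ∈ s, tateModuleMap ℓ (biproduct.π (fun _ : Fin r => A₀) j ≫ biproduct.ι (fun _ : Fin r => A₀) j) := by
      intro s
      induction s using Finset.induction_on with
      | empty => rw [Finset.sum_empty, Finset.sum_empty, tateModuleMap_zero]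
      | insert i s hi ih => rw [Finset.sum_insert hi, Finset.sum_insert hi, tateModuleMap_add, ih]
    rw [hsum, LinearMap.sum_apply]
    refine Finset.sum_congr rfl fun i _ => ?_
    rw [tateModuleMap_comp, LinearMap.comp_apply]
  have hscal : ∀ i : Fin r, biproduct.ι (fun _ : Fin r => A₀) i ≫ diag π =
      (ι₀ π : A₀ ⟶ A₀) ≫ biproduct.ι (fun _ : Fin r => A₀) i := fun i => by
    rw [hdiag, biproduct.ι_map]
  apply LinearMap.ext
  intro x
  conv_lhs => rw [← htotal x]
  conv_rhs => rw [← htotal x]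
  rw [map_sum, map_sum]
  refine Finset.sum_congr rfl fun i _ => ?_
  change P.tateRep ℓ σ₀ (Tι i (Tπ i x)) = tateModuleMap ℓ (diag π) (Tι i (Tπ i x))
  rw [← tateModuleMap_smul, hσ₀]
  change Tι i (tateModuleMap ℓ (ι₀ π : A₀ ⟶ A₀) (Tπ i x)) = _
  rw [← LinearMap.comp_apply, ← tateModuleMap_comp, ← hscal, tateModuleMap_comp, LinearMap.comp_apply]

/-! ## §3 Non-isomorphic fields generated by the two Frobenius scalars -/

/-- **If `ℚ(π₁) = K₁`, `ℚ(π₂) = K₂` and `K₁ ≄ K₂` then `π₂` is not a root of `minpoly_ℤ(π₁)`**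
(otherwise the two monic irreducible minimal polynomials over `ℚ` coincide and
`K₁ ≅ ℚ[X]/(m) ≅ K₂`). [folklore] -/
private theorem aeval_minpoly_ne_zero_of_isEmpty_algEquiv
    {K₁ K₂ : Type} [Field K₁] [NumberField K₁] [Field K₂] [NumberField K₂]
    (π₁ : 𝓞 K₁) (π₂ : 𝓞 K₂) (hπ₁ : ℚ⟮(π₁ : K₁)⟯ = ⊤) (hπ₂ : ℚ⟮(π₂ : K₂)⟯ = ⊤)
    (hK : IsEmpty (K₁ ≃ₐ[ℚ] K₂)) : aeval π₂ (minpoly ℤ π₁) ≠ 0 := by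
  intro h
  have hπ₁Q : IsIntegral ℚ (π₁ : K₁) := (NumberField.RingOfIntegers.isIntegral_coe π₁).tower_top
  have hπ₂Q : IsIntegral ℚ (π₂ : K₂) := (NumberField.RingOfIntegers.isIntegral_coe π₂).tower_top
  -- the minimal polynomial of `π₁` over `ℚ` has `π₂` as a root
  set m : ℚ[X] := minpoly ℚ (π₁ : K₁) with hm
  have hmZ : m = (minpoly ℤ π₁).map (algebraMap ℤ ℚ) := by
    rw [hm, ← NumberField.RingOfIntegers.minpoly_coe π₁]
    exact minpoly.isIntegrallyClosed_eq_field_fractions' ℚ (NumberField.RingOfIntegers.isIntegral_coe π₁)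
  have hroot : aeval (π₂ : K₂) m = 0 := by
    rw [hmZ, aeval_map_algebraMap, NumberField.RingOfIntegers.coe_eq_algebraMap, aeval_algebraMap_apply,
      h, map_zero]
  have hm₂ : m = minpoly ℚ (π₂ : K₂) :=
    minpoly.eq_of_irreducible_of_monic (minpoly.irreducible hπ₁Q) hroot (minpoly.monic hπ₁Q)
  -- `K₁ ≅ ℚ⟮π₁⟯ ≅ AdjoinRoot m ≅ ℚ⟮π₂⟯ ≅ K₂`
  have e₁ : K₁ ≃ₐ[ℚ] AdjoinRoot m :=
    (((IntermediateField.equivOfEq hπ₁).trans IntermediateField.topEquiv).symm.trans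
      (IntermediateField.adjoinRootEquivAdjoin ℚ hπ₁Q).symm)
  have e₂ : AdjoinRoot m ≃ₐ[ℚ] K₂ := by
    rw [hm₂]
    exact (IntermediateField.adjoinRootEquivAdjoin ℚ hπ₂Q).trans
      ((IntermediateField.equivOfEq hπ₂).trans IntermediateField.topEquiv)
  exact hK.false (e₁.trans e₂)

/-! ## §4 Two CM elliptic structures with different CM fields -/

/-- The «Frobenius generates `K`» step of `exists_tateRep_eq_tateModuleMap_and_adjoin_eq_top` at a
GIVEN degree-one place: for a CM elliptic structure `(A₀, ι₀)` over `k`, if the arithmetic Frobenius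
`σ` at `𝔓 ∣ v` (`v` of prime absolute norm, `v ∤ ℓ`) acts on `T_ℓ A₀` as `T_ℓ(ι₀ π)`, then
`ℚ(π) = K` (`N_{K/ℚ}(π) = N v` is a prime, so `π ∉ ℚ`). [cite: Shimura1998, §13.1 Theorem 1 (ii)] -/
private theorem adjoin_eq_top_of_tateRep_frob_eq
    {k : Type} [Field k] [NumberField k] [Algebra k ℂ] {K : Type} [Field K] [NumberField K]
    [NumberField.IsCMField K] (Φ : CMType K) (A₀ : AbelianVariety k) (ι₀ : 𝓞 K →+* End A₀)
    (hA : IsCMTypeRealisationOver Φ A₀ ι₀) (h2 : Module.finrank ℚ K = 2) (ℓ : ℕ) [Fact ℓ.Prime]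
    {v : IsDedekindDomain.HeightOneSpectrum (𝓞 k)} (hvprime : (v.residueCard).Prime)
    (hvℓ : (ℓ : 𝓞 k) ∉ v.asIdeal)
    {𝔓 : Ideal (Literature.NumberTheory.GaloisRepresentations.absIntegers (𝓞 k) k)}
    (h𝔓 : 𝔓 ∈ v.primesAbove) {σ : Field.absoluteGaloisGroup k} (hσ : IsArithFrobAt (𝓞 k) σ 𝔓)
    (π : 𝓞 K) (hσ₀ : A₀.tateRep ℓ σ = tateModuleMap ℓ (ι₀ π : A₀ ⟶ A₀)) :
    ℚ⟮(π : K)⟯ = ⊤ := by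
  classical
  have hℓk : (ℓ : k) ≠ 0 := Nat.cast_ne_zero.mpr (Fact.out : ℓ.Prime).ne_zero
  -- `N_{K/ℚ}(π) = N v`
  haveI := module_free_tateModule_holds A₀ ℓ hℓk
  haveI := module_finite_tateModule_of_cast_ne_zero A₀ ℓ hℓk
  haveI := module_finite_rationalTateModule_of_cast_ne_zero A₀ ℓ hℓk
  have hdim : A₀.dim = 1 := by have := hA.finrank_eq; omega
  have hc0 : (A₀.rationalTateRep ℓ σ).charpoly.coeff 0 = (v.residueCard : ℚ_[ℓ]) := by
    rw [A₀.coeff_zero_charpoly_rationalTateRep ℓ hℓk σ,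
      Literature.NumberTheory.GaloisRepresentations.GaloisRep.cyclotomicCharacter_apply_of_isArithFrobAt
        hvℓ h𝔓 hσ, hdim, pow_one, PadicInt.coe_natCast]
  have hchar : (A₀.rationalTateRep ℓ σ).charpoly =
      (Algebra.lmul ℚ K (π : K)).charpoly.map (algebraMap ℚ ℚ_[ℓ]) := by
    rw [A₀.charpoly_rationalTateRep_eq_map ℓ σ, hσ₀]
    exact Literature.AlgebraicGeometry.ComplexMultiplication.charpoly_tateModuleMap_map_eq_of_ringOfIntegers
      hℓk ι₀ hA.finrank_eq π
  have hnorm0 : (Algebra.lmul ℚ K (π : K)).charpoly.coeff 0 = Algebra.norm ℚ (π : K) := by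
    rw [Algebra.norm_apply, LinearMap.det_eq_sign_charpoly_coeff, h2]
    norm_num
  have hnorm : (Algebra.norm ℚ (π : K) : ℚ) = (v.residueCard : ℚ) := by
    apply (algebraMap ℚ ℚ_[ℓ]).injective
    rw [← hnorm0, ← Polynomial.coeff_map, ← hchar, hc0, map_natCast]
  -- `π ∉ ℚ`: `N v` is a prime, not a rational square
  have hπQ : IsIntegral ℚ (π : K) := (NumberField.RingOfIntegers.isIntegral_coe π).tower_top
  have hnotmem : (π : K) ∉ (algebraMap ℚ K).range := by
    rintro ⟨r, hr⟩
    have hsq : r ^ 2 = (v.residueCard : ℚ) := by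
      rw [← hnorm, ← hr, Algebra.norm_algebraMap, h2]
    have hp : (v.residueCard).Prime := hvprime
    have hr0 : r ≠ 0 := by
      rintro rfl
      rw [zero_pow two_ne_zero] at hsq
      exact hp.ne_zero (by exact_mod_cast hsq.symm)
    haveI : Fact (v.residueCard).Prime := ⟨hp⟩
    have hval := congrArg (padicValRat v.residueCard) hsq
    rw [padicValRat.pow, padicValRat.self hp.one_lt] at hval
    omega
  -- hence `ℚ(π) = K`
  have h2le : 2 ≤ Module.finrank ℚ ℚ⟮(π : K)⟯ := by
    rw [IntermediateField.adjoin.finrank hπQ]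
    exact (minpoly.two_le_natDegree_iff hπQ).mpr hnotmem
  have htower := Module.finrank_mul_finrank ℚ ℚ⟮(π : K)⟯ K
  have hpos : 0 < Module.finrank ℚ⟮(π : K)⟯ K := Module.finrank_pos
  have hfin : Module.finrank ℚ ℚ⟮(π : K)⟯ = Module.finrank ℚ K := by
    rw [h2] at htower ⊢
    nlinarith
  exact IntermediateField.eq_of_le_of_finrank_eq le_top
    (hfin.trans (IntermediateField.finrank_top' (F := ℚ) (E := K)).symm)

/-- **One Frobenius for two CM elliptic structures** (Shimura–Taniyama at a common degree-one place,
granted [Shimura 1998, Thm. 18.6]): for CM elliptic structures `(A₁, ι₁)` of type `(K₁, Φ₁)` and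
`(A₂, ι₂)` of type `(K₂, Φ₂)` over the same number field `k` and a prime `ℓ`, there are `σ₀ ∈ Γ_k`
and `π_i ∈ 𝓞_{K_i}` with `ρ_{A_i,ℓ}(σ₀) = T_ℓ(ι_i π_i)` and `ℚ(π_i) = K_i` (`i = 1, 2`) — the two
cofinite sets of good places of `shimuraTaniyama_heckeCharactersST_eventually_of_thm18_6` meet the
infinite set of degree-one places (`infinite_setOf_prime_absNorm_frobenius_restrict_eq`).
[cite: Shimura1998, §13.1 Theorem 1 (ii) and §18.6 Theorem 18.6] [cite: SerreTate1968, §7 Theorems 10–11] -/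
theorem exists_common_tateRep_eq_of_CM_elliptic_pair (h186 : shimura1998_thm18_6)
    {k : Type} [Field k] [NumberField k] [Algebra k ℂ] {K₁ K₂ : Type} [Field K₁] [NumberField K₁]
    [NumberField.IsCMField K₁] [Field K₂] [NumberField K₂] [NumberField.IsCMField K₂]
    (Φ₁ : CMType K₁) (A₁ : AbelianVariety k) (ι₁ : 𝓞 K₁ →+* End A₁)
    (hA₁ : IsCMTypeRealisationOver Φ₁ A₁ ι₁) (h2₁ : Module.finrank ℚ K₁ = 2)
    (Φ₂ : CMType K₂) (A₂ : AbelianVariety k) (ι₂ : 𝓞 K₂ →+* End A₂)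
    (hA₂ : IsCMTypeRealisationOver Φ₂ A₂ ι₂) (h2₂ : Module.finrank ℚ K₂ = 2) (ℓ : ℕ) [Fact ℓ.Prime] :
    ∃ (σ₀ : Field.absoluteGaloisGroup k) (π₁ : 𝓞 K₁) (π₂ : 𝓞 K₂),
      (A₁.tateRep ℓ σ₀ = tateModuleMap ℓ (ι₁ π₁ : A₁ ⟶ A₁) ∧ ℚ⟮(π₁ : K₁)⟯ = ⊤) ∧
      (A₂.tateRep ℓ σ₀ = tateModuleMap ℓ (ι₂ π₂ : A₂ ⟶ A₂) ∧ ℚ⟮(π₂ : K₂)⟯ = ⊤) := by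
  classical
  have hℓ0 : (ℓ : 𝓞 k) ≠ 0 := Nat.cast_ne_zero.mpr (Fact.out : ℓ.Prime).ne_zero
  -- (5ST) at cofinitely many places, for both structures
  obtain ⟨χ₁, -, -, -, hev₁⟩ :=
    shimuraTaniyama_heckeCharactersST_eventually_of_thm18_6 h186 k K₁ Φ₁ A₁ ι₁ hA₁
  obtain ⟨χ₂, -, -, -, hev₂⟩ :=
    shimuraTaniyama_heckeCharactersST_eventually_of_thm18_6 h186 k K₂ Φ₂ A₂ ι₂ hA₂
  rw [Filter.eventually_cofinite] at hev₁ hev₂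
  -- the primes above `ℓ` are finitely many
  have hℓfin : {v : IsDedekindDomain.HeightOneSpectrum (𝓞 k) | (ℓ : 𝓞 k) ∈ v.asIdeal}.Finite := by
    refine (Ideal.finite_factors (I := Ideal.span {(ℓ : 𝓞 k)}) ?_).subset fun v hv => ?_
    · rw [Ideal.zero_eq_bot, Ne, Ideal.span_singleton_eq_bot]; exact hℓ0
    · exact (Ideal.dvd_span_singleton).mpr hv
  -- Chebotarev: infinitely many degree-one places with an arithmetic Frobenius
  have hinf := Literature.NumberTheory.GaloisRepresentations.infinite_setOf_prime_absNorm_frobenius_restrict_eq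
    (F := k) ⊥ 1
  obtain ⟨v, ⟨hvprime, -, 𝔓, h𝔓, σ, hσ, -⟩, hvnot⟩ :=
    (hinf.sdiff ((hev₁.union hev₂).union hℓfin)).nonempty
  simp only [Set.mem_union, Set.mem_setOf_eq, not_or, not_not] at hvnot
  obtain ⟨⟨⟨π₁, -, hfrob₁, -⟩, ⟨π₂, -, hfrob₂, -⟩⟩, hvℓ⟩ := hvnot
  have hσ₁ : A₁.tateRep ℓ σ = tateModuleMap ℓ (ι₁ π₁ : A₁ ⟶ A₁) := hfrob₁ ℓ hvℓ 𝔓 h𝔓 σ hσ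
  have hσ₂ : A₂.tateRep ℓ σ = tateModuleMap ℓ (ι₂ π₂ : A₂ ⟶ A₂) := hfrob₂ ℓ hvℓ 𝔓 h𝔓 σ hσ
  exact ⟨σ, π₁, π₂, ⟨hσ₁, adjoin_eq_top_of_tateRep_frob_eq Φ₁ A₁ ι₁ hA₁ h2₁ ℓ hvprime hvℓ h𝔓 hσ π₁ hσ₁⟩,
    ⟨hσ₂, adjoin_eq_top_of_tateRep_frob_eq Φ₂ A₂ ι₂ hA₂ h2₂ ℓ hvprime hvℓ h𝔓 hσ π₂ hσ₂⟩⟩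

/-- **[Fal83 §5 Kor. 1] across two CM fields, generic form**: if one `σ₀` acts on `T_ℓ A₁` as
`T_ℓ(ι₁ π₁)` and on `T_ℓ A₂` as `T_ℓ(ι₂ π₂)` with `m₁(π₂) ≠ 0` (`m₁ = minpoly_ℤ(π₁)`), then
`faltings_tate_bijective A B ℓ` for every `A` isogenous to `A₁ᵃ` and every `B` isogenous to `A₂ᶜ`
(powers: `exists_ringHom_biproduct_tateRep_eq`; vanishing: §1; isogeny invariance:
`faltings_tate_bijective_of_isIsogenous`). [cite: Faltings1983Endlichkeit, §5 Korollar 1]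
[cite: SerreTate1968, §4 Theorem 5 and Corollary 1] -/
theorem faltings_tate_bijective_of_isIsogenous_pow_pow_of_tateRep_eq_of_aeval_ne_zero
    {k : Type} [Field k] {K₁ K₂ : Type*} [Field K₁] [NumberField K₁] [Field K₂] [NumberField K₂]
    (A₁ A₂ : AbelianVariety k) (ι₁ : 𝓞 K₁ →+* End A₁) (ι₂ : 𝓞 K₂ →+* End A₂) (ℓ : ℕ) [Fact ℓ.Prime]
    (σ₀ : Field.absoluteGaloisGroup k) (π₁ : 𝓞 K₁) (π₂ : 𝓞 K₂)
    (h₁ : A₁.tateRep ℓ σ₀ = tateModuleMap ℓ (ι₁ π₁ : A₁ ⟶ A₁))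
    (h₂ : A₂.tateRep ℓ σ₀ = tateModuleMap ℓ (ι₂ π₂ : A₂ ⟶ A₂))
    (hu : aeval π₂ (minpoly ℤ π₁) ≠ 0) {a c : ℕ} {A B : AbelianVariety k}
    (hA : IsIsogenous (⨁ fun _ : Fin a => A₁) A) (hB : IsIsogenous (⨁ fun _ : Fin c => A₂) B) :
    faltings_tate_bijective A B ℓ := by
  obtain ⟨ιa, hιa⟩ := exists_ringHom_biproduct_tateRep_eq A₁ ι₁ ℓ σ₀ π₁ h₁ a
  obtain ⟨ιc, hιc⟩ := exists_ringHom_biproduct_tateRep_eq A₂ ι₂ ℓ σ₀ π₂ h₂ c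
  refine faltings_tate_bijective_of_isIsogenous ℓ hA hB ?_
  intro hk
  exact bijective_faltingsTateMap_of_tateRep_eq_of_aeval_ne_zero _ _ ιa ιc ℓ σ₀ π₁ π₂ hιa hιc hu

/-- **[Faltings 1983, §5 Kor. 1] for powers of two CM elliptic structures with non-isomorphic CM
fields**, granted [Shimura 1998, Thm. 18.6]: for CM elliptic structures `(A₁, ι₁)` of type `(K₁, Φ₁)`
and `(A₂, ι₂)` of type `(K₂, Φ₂)` over the same field `k` (`k → ℂ`; the predicate quantifies over
`[NumberField k]`) with `[K_i : ℚ] = 2` and `K₁ ≄ K₂`, every `A` isogenous to `A₁ᵃ`, every `B`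
isogenous to `A₂ᵇ` and every prime `ℓ`, the Tate map `ℤ_ℓ ⊗ Hom_k(A, B) → Hom_{Γ_k}(T_ℓ A, T_ℓ B)` is
bijective (both sides vanish). [cite: Faltings1983Endlichkeit, §5 Korollar 1]
[cite: Shimura1998, §13.1 Theorem 1 (ii) and §18.6 Theorem 18.6] [cite: SerreTate1968, §4 Corollary 1] -/
theorem faltings_tate_bijective_of_isIsogenous_pow_of_distinct_CM_elliptic_of_thm18_6
    (h186 : shimura1998_thm18_6) :
    ∀ {k : Type} [Field k] [Algebra k ℂ] {K₁ K₂ : Type} [Field K₁] [NumberField K₁]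
      [NumberField.IsCMField K₁] [Field K₂] [NumberField K₂] [NumberField.IsCMField K₂]
      (Φ₁ : CMType K₁) (A₁ : AbelianVariety k) (ι₁ : 𝓞 K₁ →+* End A₁)
      (Φ₂ : CMType K₂) (A₂ : AbelianVariety k) (ι₂ : 𝓞 K₂ →+* End A₂),
      IsCMTypeRealisationOver Φ₁ A₁ ι₁ → Module.finrank ℚ K₁ = 2 →
      IsCMTypeRealisationOver Φ₂ A₂ ι₂ → Module.finrank ℚ K₂ = 2 → IsEmpty (K₁ ≃ₐ[ℚ] K₂) →
      ∀ (a b : ℕ) (A B : AbelianVariety k), IsIsogenous (⨁ fun _ : Fin a => A₁) A →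
        IsIsogenous (⨁ fun _ : Fin b => A₂) B → ∀ (ℓ : ℕ) [Fact ℓ.Prime],
        faltings_tate_bijective A B ℓ := by
  intro k _ _ K₁ K₂ _ _ _ _ _ _ Φ₁ A₁ ι₁ Φ₂ A₂ ι₂ hA₁ h2₁ hA₂ h2₂ hK a b A B hA hB ℓ _ hk
  obtain ⟨σ₀, π₁, π₂, ⟨hσ₁, hπ₁⟩, ⟨hσ₂, hπ₂⟩⟩ :=
    exists_common_tateRep_eq_of_CM_elliptic_pair h186 Φ₁ A₁ ι₁ hA₁ h2₁ Φ₂ A₂ ι₂ hA₂ h2₂ ℓ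
  have hu := aeval_minpoly_ne_zero_of_isEmpty_algEquiv π₁ π₂ hπ₁ hπ₂ hK
  exact faltings_tate_bijective_of_isIsogenous_pow_pow_of_tateRep_eq_of_aeval_ne_zero A₁ A₂ ι₁ ι₂ ℓ
    σ₀ π₁ π₂ hσ₁ hσ₂ hu hA hB

end Literature.NumberTheory.ComplexMultiplication

end
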